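import Literature.NumberTheory.Sieve.CFSemigroupCounting
import HarnessLib

/-!
# Convergents of bounded-digit continued fractions (support for `CFSemigroupCounting`)

Continued-fraction bookkeeping for the continued fractions semigroup `Γ_A` of Magee–Oh–Winter
[MageeOhWinter2019, §1, §2.1 II]: for a digit sequence `d : ℕ → ℕ` the word matrices
`M_n = g_{d 0} ⋯ g_{d (n-1)} = (p_{n-1} p_n; q_{n-1} q_n)` (`cfWord`), the convergents
`x_n = p_n/q_n = M_n(0)` (`cfConv`), their limit `[0; d 0, d 1, …]` (`cfValue`, with
`|x_{n+1} - x_n| = 1/(q_n q_{n+1}) ≤ 2^{-n}`, `tendsto_cfConv_cfValue`), the growth bounds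
`2^n ≤ q_n q_{n+1}`, `2^n ≤ q_{2n}`, `q_n ≤ (B+1)^n` for digits in `[1, B]`, and membership of the
even words in `Γ_A` (`cfWord_mem_cfSemigroup`). The separation estimate for the values lives in
`CFSemigroupSeparation.lean`, the dimension bound in `CFSemigroupDimension.lean`. Everything here
is folklore (Euler–Wallis recurrences) and fully proved.

## References

* M. Magee, H. Oh, D. Winter, J. reine angew. Math. 753 (2019) 89–135, §2.1 II. [MageeOhWinter2019]
-/
noncomputable section

open Filter Set
open scoped Topology

namespace Literature.NumberTheory.Sieve

/-! ### Word matrices -/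

/-- The word matrix `M_n = g_{d 0} g_{d 1} ⋯ g_{d (n-1)}` of the first `n` digits of `d`
(`M_0 = 1`). Its columns are consecutive convergent vectors: `M_n = (p_{n-1} p_n; q_{n-1} q_n)`.
[folklore] -/
def cfWord (d : ℕ → ℕ) : ℕ → Matrix (Fin 2) (Fin 2) ℤ
  | 0 => 1
  | n + 1 => cfWord d n * cfGen (d n)

variable (d : ℕ → ℕ)

/-- `M_0 = 1`. [folklore] -/
@[simp] theorem cfWord_zero : cfWord d 0 = 1 := rfl

/-- `M_{n+1} = M_n g_{d n}`. [folklore] -/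
theorem cfWord_succ (n : ℕ) : cfWord d (n + 1) = cfWord d n * cfGen (d n) := rfl

/-- Entry recurrence, `(0,0)`: `M_{n+1} 0 0 = M_n 0 1`. [folklore] -/
theorem cfWord_succ_00 (n : ℕ) : cfWord d (n + 1) 0 0 = cfWord d n 0 1 := by
  simp [cfWord_succ, cfGen, Matrix.mul_apply, Fin.sum_univ_two]

/-- Entry recurrence, `(0,1)`: `p_{n+1} = p_{n-1} + d_n p_n`. [folklore] -/
theorem cfWord_succ_01 (n : ℕ) :
    cfWord d (n + 1) 0 1 = cfWord d n 0 0 + cfWord d n 0 1 * d n := by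
  simp [cfWord_succ, cfGen, Matrix.mul_apply, Fin.sum_univ_two]

/-- Entry recurrence, `(1,0)`: `M_{n+1} 1 0 = M_n 1 1`. [folklore] -/
theorem cfWord_succ_10 (n : ℕ) : cfWord d (n + 1) 1 0 = cfWord d n 1 1 := by
  simp [cfWord_succ, cfGen, Matrix.mul_apply, Fin.sum_univ_two]

/-- Entry recurrence, `(1,1)`: `q_{n+1} = q_{n-1} + d_n q_n`. [folklore] -/
theorem cfWord_succ_11 (n : ℕ) :
    cfWord d (n + 1) 1 1 = cfWord d n 1 0 + cfWord d n 1 1 * d n := by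
  simp [cfWord_succ, cfGen, Matrix.mul_apply, Fin.sum_univ_two]

/-- `det M_n = (-1)^n`. [folklore] -/
theorem det_cfWord (n : ℕ) : (cfWord d n).det = (-1) ^ n := by
  induction n with
  | zero => simp
  | succ n ih => rw [cfWord_succ, Matrix.det_mul, ih, det_cfGen, pow_succ]

/-- `M_n` is the product of the list of generators `[g_{d 0}, …, g_{d (n-1)}]`. [folklore] -/
theorem cfWord_eq_prod (n : ℕ) : cfWord d n = (((List.range n).map d).map cfGen).prod := by
  induction n with
  | zero => simp
  | succ n ih =>
      rw [cfWord_succ, ih, List.range_succ, List.map_append, List.map_append, List.prod_append]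
      simp

/-- A nonempty even word in digits from `A` lies in `Γ_A`. [folklore] -/
theorem cfWord_mem_cfSemigroup {A : Finset ℕ} {d : ℕ → ℕ} (hd : ∀ i, d i ∈ A) {n : ℕ}
    (hn : n ≠ 0) (he : Even n) : cfWord d n ∈ cfSemigroup A := by
  refine ⟨(List.range n).map d, ?_, ?_, ?_, (cfWord_eq_prod d n).symm⟩
  · simpa using hn
  · simpa using he
  · intro a ha
    obtain ⟨i, -, rfl⟩ := List.mem_map.1 ha
    exact hd i

/-- The word matrix depends only on the digits it reads. [folklore] -/
theorem cfWord_congr {d d' : ℕ → ℕ} {n : ℕ} (h : ∀ i < n, d i = d' i) :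
    cfWord d n = cfWord d' n := by
  induction n with
  | zero => rfl
  | succ n ih =>
      rw [cfWord_succ, cfWord_succ, ih fun i hi => h i (Nat.lt_succ_of_lt hi),
        h n (Nat.lt_succ_self n)]

/-- Splitting a word: `M_{m+n}(d) = M_n(d) · M_m(σⁿ d)` with `σ` the shift. [folklore] -/
theorem cfWord_add (n m : ℕ) :
    cfWord d (m + n) = cfWord d n * cfWord (fun i => d (i + n)) m := by
  induction m with
  | zero => simp
  | succ m ih =>
      rw [Nat.add_right_comm, cfWord_succ, ih, cfWord_succ, Matrix.mul_assoc]

/-- All entries of `M_n` are nonnegative. [folklore] -/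
theorem cfWord_nonneg (n : ℕ) : ∀ i j, 0 ≤ cfWord d n i j := by
  induction n with
  | zero => intro i j; fin_cases i <;> fin_cases j <;> simp
  | succ n ih =>
      intro i j
      have h00 := ih 0 0; have h01 := ih 0 1; have h10 := ih 1 0; have h11 := ih 1 1
      fin_cases i <;> fin_cases j
      · simpa [cfWord_succ_00] using h01
      · simp only [Fin.zero_eta, Fin.mk_one, cfWord_succ_01]; positivity
      · simpa [cfWord_succ_10] using h11
      · simp only [Fin.mk_one, cfWord_succ_11]; positivity

/-! ### Numerators, denominators, convergents -/

/-- `p_n := M_n 0 1`, the numerator of the `n`-th convergent. [folklore] -/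
def cfNum (n : ℕ) : ℤ := cfWord d n 0 1

/-- `q_n := M_n 1 1`, the denominator of the `n`-th convergent. [folklore] -/
def cfDen (n : ℕ) : ℤ := cfWord d n 1 1

/-- `p_0 = 0`. [folklore] -/
@[simp] theorem cfNum_zero : cfNum d 0 = 0 := by simp [cfNum]

/-- `q_0 = 1`. [folklore] -/
@[simp] theorem cfDen_zero : cfDen d 0 = 1 := by simp [cfDen]

/-- `p_1 = 1`. [folklore] -/
@[simp] theorem cfNum_one : cfNum d 1 = 1 := by simp [cfNum, cfWord_succ_01]

/-- `q_1 = d 0`. [folklore] -/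
@[simp] theorem cfDen_one : cfDen d 1 = d 0 := by simp [cfDen, cfWord_succ_11]

/-- `p_{n+1} = M_n 0 0 + d_n p_n`. [folklore] -/
theorem cfNum_succ (n : ℕ) : cfNum d (n + 1) = cfWord d n 0 0 + cfNum d n * d n :=
  cfWord_succ_01 d n

/-- `q_{n+1} = M_n 1 0 + d_n q_n`. [folklore] -/
theorem cfDen_succ (n : ℕ) : cfDen d (n + 1) = cfWord d n 1 0 + cfDen d n * d n :=
  cfWord_succ_11 d n

/-- `q_{n+2} = q_n + d_{n+1} q_{n+1}`. [folklore] -/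
theorem cfDen_add_two (n : ℕ) : cfDen d (n + 2) = cfDen d n + cfDen d (n + 1) * d (n + 1) := by
  rw [cfDen_succ, cfWord_succ_10]; rfl

/-- `p_{n+1} q_n - p_n q_{n+1} = (-1)^n`. [folklore] -/
theorem cfNum_succ_mul_cfDen_sub (n : ℕ) :
    cfNum d (n + 1) * cfDen d n - cfNum d n * cfDen d (n + 1) = (-1) ^ n := by
  have h := det_cfWord d n
  rw [Matrix.det_fin_two] at h
  rw [cfNum_succ, cfDen_succ]
  simp only [cfNum, cfDen]
  linear_combination h

variable {d}

/-- `q_n ≥ 1` when all digits are `≥ 1`. [folklore] -/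
theorem one_le_cfDen (hd : ∀ i, 1 ≤ d i) (n : ℕ) : 1 ≤ cfDen d n := by
  induction n with
  | zero => simp
  | succ n ih =>
      rw [cfDen_succ]
      have h10 := cfWord_nonneg d n 1 0
      have h1 : (1 : ℤ) ≤ d n := by exact_mod_cast hd n
      nlinarith

/-- `q_n ≤ q_{n+1}` when all digits are `≥ 1`. [folklore] -/
theorem cfDen_le_succ (hd : ∀ i, 1 ≤ d i) (n : ℕ) : cfDen d n ≤ cfDen d (n + 1) := by
  rw [cfDen_succ]
  have h10 := cfWord_nonneg d n 1 0
  have h1 : (1 : ℤ) ≤ d n := by exact_mod_cast hd n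
  have h11 : (1 : ℤ) ≤ cfDen d n := one_le_cfDen hd n
  nlinarith

/-- `M_n 1 0 = q_{n-1} ≤ q_n`. [folklore] -/
theorem cfWord_10_le_cfDen (hd : ∀ i, 1 ≤ d i) : ∀ n, cfWord d n 1 0 ≤ cfDen d n
  | 0 => by simp
  | n + 1 => by rw [cfWord_succ_10]; exact cfDen_le_succ hd n

/-- `2^n ≤ q_n q_{n+1}` (so `1/(q_n q_{n+1}) ≤ 2^{-n}`). [folklore] -/
theorem pow_le_cfDen_mul (hd : ∀ i, 1 ≤ d i) : ∀ n : ℕ, (2 : ℤ) ^ n ≤ cfDen d n * cfDen d (n + 1)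
  | 0 => by simpa using hd 0
  | n + 1 => by
      have ih := pow_le_cfDen_mul hd n
      have hmono := cfDen_le_succ hd n
      have h1 : (1 : ℤ) ≤ d (n + 1) := by exact_mod_cast hd (n + 1)
      have h0' : (0 : ℤ) ≤ cfDen d (n + 1) := zero_le_one.trans (one_le_cfDen hd (n + 1))
      have hA : cfDen d n * cfDen d (n + 1) ≤ cfDen d (n + 1) * cfDen d (n + 1) :=
        mul_le_mul_of_nonneg_right hmono h0'
      have hB : cfDen d (n + 1) * cfDen d (n + 1) * 1 ≤
          cfDen d (n + 1) * cfDen d (n + 1) * d (n + 1) :=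
        mul_le_mul_of_nonneg_left h1 (mul_nonneg h0' h0')
      rw [cfDen_add_two, pow_succ]
      nlinarith

/-- `2^n ≤ q_{2n}`. [folklore] -/
theorem pow_le_cfDen_two_mul (hd : ∀ i, 1 ≤ d i) : ∀ n : ℕ, (2 : ℤ) ^ n ≤ cfDen d (2 * n)
  | 0 => by simp
  | n + 1 => by
      have ih := pow_le_cfDen_two_mul hd n
      have hmono := cfDen_le_succ hd (2 * n)
      have h1 : (1 : ℤ) ≤ d (2 * n + 1) := by exact_mod_cast hd (2 * n + 1)
      have h0' : (0 : ℤ) ≤ cfDen d (2 * n + 1) := zero_le_one.trans (one_le_cfDen hd _)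
      have hB : cfDen d (2 * n + 1) * 1 ≤ cfDen d (2 * n + 1) * d (2 * n + 1) :=
        mul_le_mul_of_nonneg_left h1 h0'
      rw [show 2 * (n + 1) = 2 * n + 2 by ring, cfDen_add_two, pow_succ]
      nlinarith

/-- `q_{n+1} ≤ (B+1) q_n` when all digits are `≤ B`. [folklore] -/
theorem cfDen_succ_le (hd : ∀ i, 1 ≤ d i) {B : ℕ} (hB : ∀ i, d i ≤ B) (n : ℕ) :
    cfDen d (n + 1) ≤ (B + 1) * cfDen d n := by
  have h10 := cfWord_10_le_cfDen hd n
  have hBn : (d n : ℤ) ≤ B := by exact_mod_cast hB n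
  have h0 : (0 : ℤ) ≤ cfDen d n := zero_le_one.trans (one_le_cfDen hd n)
  have hC : cfDen d n * (d n : ℤ) ≤ cfDen d n * B := mul_le_mul_of_nonneg_left hBn h0
  rw [cfDen_succ]
  nlinarith

/-- `q_n ≤ (B+1)^n` when all digits are in `[1, B]`. [folklore] -/
theorem cfDen_le_pow (hd : ∀ i, 1 ≤ d i) {B : ℕ} (hB : ∀ i, d i ≤ B) :
    ∀ n : ℕ, cfDen d n ≤ ((B : ℤ) + 1) ^ n
  | 0 => by simp
  | n + 1 => by
      have ih := cfDen_le_pow hd hB n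
      have h := cfDen_succ_le hd hB n
      have hB0 : (0 : ℤ) ≤ (B : ℤ) + 1 := by positivity
      calc cfDen d (n + 1) ≤ (B + 1) * cfDen d n := h
        _ ≤ (B + 1) * ((B : ℤ) + 1) ^ n := mul_le_mul_of_nonneg_left ih hB0
        _ = ((B : ℤ) + 1) ^ (n + 1) := by ring

/-- `0 ≤ p_n`. [folklore] -/
theorem cfNum_nonneg (d : ℕ → ℕ) (n : ℕ) : 0 ≤ cfNum d n := cfWord_nonneg d n 0 1

/-- `M_{m+1} 0 0 ≤ M_{m+1} 1 0` and `p_{m+1} ≤ q_{m+1}`. [folklore] -/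
theorem cfWord_fst_le_snd (hd : ∀ i, 1 ≤ d i) :
    ∀ m : ℕ, cfWord d (m + 1) 0 0 ≤ cfWord d (m + 1) 1 0 ∧ cfNum d (m + 1) ≤ cfDen d (m + 1)
  | 0 => by
      refine ⟨?_, ?_⟩
      · rw [cfWord_succ_00, cfWord_succ_10]; simp
      · simpa using hd 0
  | m + 1 => by
      obtain ⟨h1, h2⟩ := cfWord_fst_le_snd hd m
      simp only [cfNum, cfDen] at h2
      refine ⟨?_, ?_⟩
      · rw [cfWord_succ_00, cfWord_succ_10]; exact h2
      · show cfWord d (m + 2) 0 1 ≤ cfWord d (m + 2) 1 1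
        rw [cfWord_succ_01, cfWord_succ_11]
        have h0 : (0 : ℤ) ≤ d (m + 1) := by positivity
        have hC := mul_le_mul_of_nonneg_right h2 h0
        linarith

/-- `p_n ≤ q_n`: the convergents lie in `[0, 1]`. [folklore] -/
theorem cfNum_le_cfDen (hd : ∀ i, 1 ≤ d i) : ∀ n, cfNum d n ≤ cfDen d n
  | 0 => by simp
  | n + 1 => (cfWord_fst_le_snd hd n).2

variable (d)

/-- The `n`-th convergent `x_n = p_n / q_n = M_n(0) = [0; d 0, …, d (n-1)]` as a real number.
[folklore] -/
def cfConv (n : ℕ) : ℝ := (cfNum d n : ℝ) / (cfDen d n : ℝ)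

/-- `x_0 = 0`. [folklore] -/
@[simp] theorem cfConv_zero : cfConv d 0 = 0 := by simp [cfConv]

variable {d}

/-- `0 < q_n` in `ℝ`. [folklore] -/
theorem cfDen_cast_pos (hd : ∀ i, 1 ≤ d i) (n : ℕ) : (0 : ℝ) < (cfDen d n : ℝ) := by
  exact_mod_cast (one_le_cfDen hd n).trans_lt' zero_lt_one

/-- `x_n ∈ [0, 1]`. [folklore] -/
theorem cfConv_mem_Icc (hd : ∀ i, 1 ≤ d i) (n : ℕ) : cfConv d n ∈ Icc (0 : ℝ) 1 := by
  have hq := cfDen_cast_pos hd n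
  have hp : (0 : ℝ) ≤ (cfNum d n : ℝ) := by exact_mod_cast cfNum_nonneg d n
  have hpq : (cfNum d n : ℝ) ≤ (cfDen d n : ℝ) := by exact_mod_cast cfNum_le_cfDen hd n
  exact ⟨div_nonneg hp hq.le, (div_le_one hq).2 hpq⟩

/-- `x_{n+1} - x_n = (-1)^n / (q_n q_{n+1})`. [folklore] -/
theorem cfConv_succ_sub (hd : ∀ i, 1 ≤ d i) (n : ℕ) :
    cfConv d (n + 1) - cfConv d n = (-1) ^ n / ((cfDen d n : ℝ) * cfDen d (n + 1)) := by
  have hq := (cfDen_cast_pos hd n).ne'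
  have hq' := (cfDen_cast_pos hd (n + 1)).ne'
  have h : (cfNum d (n + 1) : ℝ) * cfDen d n - cfNum d n * cfDen d (n + 1) = (-1) ^ n := by
    exact_mod_cast cfNum_succ_mul_cfDen_sub d n
  rw [cfConv, cfConv, div_sub_div _ _ hq' hq, ← h]
  congr 1 <;> ring

/-- `|x_{n+1} - x_n| ≤ 2^{-n}`. [folklore] -/
theorem abs_cfConv_succ_sub_le (hd : ∀ i, 1 ≤ d i) (n : ℕ) :
    |cfConv d (n + 1) - cfConv d n| ≤ ((1 : ℝ) / 2) ^ n := by
  have hq := cfDen_cast_pos hd n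
  have hq' := cfDen_cast_pos hd (n + 1)
  have h2 : ((2 : ℝ) ^ n) ≤ (cfDen d n : ℝ) * cfDen d (n + 1) := by
    exact_mod_cast pow_le_cfDen_mul hd n
  rw [cfConv_succ_sub hd, abs_div, abs_pow, abs_neg, abs_one, one_pow,
    abs_of_pos (mul_pos hq hq'), one_div_pow]
  exact one_div_le_one_div_of_le (by positivity) h2

/-- The differences `x_{n+1} - x_n` are absolutely summable. [folklore] -/
theorem summable_cfConv_succ_sub (hd : ∀ i, 1 ≤ d i) :
    Summable fun n => cfConv d (n + 1) - cfConv d n :=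
  Summable.of_norm_bounded summable_geometric_two fun n => by
    simpa only [Real.norm_eq_abs] using abs_cfConv_succ_sub_le hd n

variable (d)

/-- The value `[0; d 0, d 1, d 2, …] = lim x_n` of the infinite continued fraction, defined as
the sum of the (absolutely convergent) telescoping series `Σ (x_{n+1} - x_n)`. [folklore] -/
def cfValue : ℝ := ∑' n, (cfConv d (n + 1) - cfConv d n)

variable {d}

/-- `x_n → [0; d 0, d 1, …]`. [folklore] -/
theorem tendsto_cfConv_cfValue (hd : ∀ i, 1 ≤ d i) :
    Tendsto (cfConv d) atTop (𝓝 (cfValue d)) := by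
  have h := (summable_cfConv_succ_sub hd).hasSum.tendsto_sum_nat
  refine h.congr fun n => ?_
  rw [Finset.sum_range_sub, cfConv_zero, sub_zero]

/-- `[0; d 0, d 1, …] ∈ [0, 1]`. [folklore] -/
theorem cfValue_mem_Icc (hd : ∀ i, 1 ≤ d i) : cfValue d ∈ Icc (0 : ℝ) 1 :=
  isClosed_Icc.mem_of_tendsto (tendsto_cfConv_cfValue hd)
    (Eventually.of_forall fun n => cfConv_mem_Icc hd n)

end Literature.NumberTheory.Sieve
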